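import Summits.AnomalousDissipation.AnomalousDissipation.Theorems.MarginalStabilityChainStrainedLayerLawClockCentroidLaw
import HarnessLib

/-!
# Crux `MarginalStabilityChain.StrainedLayerLaw` (stmt-AnomalousDissipation-3007), line `FirstLemmasR2K4`
# (log-enstrophy clock + Nash roundness): the circulation-density law — tools (slice identities, cutoff limits)

Support file (`--supports stmt-AnomalousDissipation-3007`; registered sub-goal `circLaw_tools`, the tools of the
registered sub-goal `circulationDensity_weak_law` of line `FirstLemmasR2K4`, lead c7, wave 2). For one `C²`
divergence-free `L`-periodic slice `(u, v)` with shear tails `SliceTails C k u v` and the shear far field `u → ±½`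
(`ω = ∂ₓv − ∂_yu`), and an `L`-periodic test function `χ(x)` (in the law: `χ = φ′`):
* `∫∫ ω u χ = −∫∫ χ′ uv` over the period strip (`ωu = u∂ₓv − ∂_y(u²/2)`; `∫_y ∂_y(u²/2) = 0` since `u² → ¼` at both
  ends; `∫∫ χu ∂ₓv = −∫∫ (χ′u + χ∂ₓu)v` by periodicity; `∫∫ χ(∂ₓu)v = −∫∫ χ v∂_yv = 0` since `v → 0`);
* `∫∫ (∂ₓω)χ = −∫∫ χ′ω` (integration by parts in `x` over a period);
* for a cutoff family `ψ_R(y)` (`|ψ_R| ≤ 1`, `|ψ_R′| ≤ D` for `R ≥ 1`, `ψ_R(y) = 1`, `ψ_R′(y) = 0` eventually as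
  `R → ∞`) and bounded `φ, φ′`: the pointwise majorants and the limits `R → ∞` (dominated convergence on the strip) of
  the three strip functionals of the weak vorticity balance tested against `Φ_R(x, y) = φ(x)ψ_R(y)`:
  `∫∫ φψ_R ω → ∫∫ φω`, `∫∫ ω(uφ′ψ_R + (v − y)φψ_R′) → ∫∫ ωuφ′`, `∫∫ (∂ₓω φ′ψ_R + ∂_yω φψ_R′) → ∫∫ ∂ₓω φ′`.
The main file (`…ClockCirculationDensityLaw.lean`) integrates the balance in time and removes the cutoff.
All `[folklore]` (the `x`-moment bookkeeping of 2-D vorticity dynamics in a strain: e.g. Majda–Bertozzi,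
*Vorticity and Incompressible Flow*, CUP 2002, §1.4; the weak vorticity balance is `stub_vorticityUniformBounds_weakVorticity`).
-/

-- `Summit.<Summit>.<Problem>` is the tree's mandated summit-side namespace (CONVENTIONS §2); for this
-- single-conjunct summit the two coincide, so the duplicate is deliberate.
set_option linter.dupNamespace false

noncomputable section

open scoped Topology ENNReal
open Filter Set Function MeasureTheory

namespace Summit.AnomalousDissipation.AnomalousDissipation.Theorems.StrainedLayerLaw.LogEnstrophyClock

open Literature.Analysis.FluidPDE Literature.Analysis.FluidPDE.StretchedLayer
open Summit.AnomalousDissipation.AnomalousDissipation.Theses.MarginalStabilityChain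
open Summit.AnomalousDissipation.AnomalousDissipation.Theorems.StrainedLayerLaw.StrainWorkSumRule

/-! ## Slice identities: `∫∫ ωuχ = −∫∫ χ′uv`, `∫∫ (∂ₓω)χ = −∫∫ χ′ω` -/

section SliceFacts

variable {L C k : ℝ} {f g : ℝ → ℝ → ℝ}

/-- `|a| ≤ M`, `|b| ≤ Ce^{−k|y|}` give `|ab| ≤ MC e^{−k|y|}`. [folklore] -/
theorem circLaw_abs_mul_le {a b M C k y : ℝ} (ha : |a| ≤ M) (hb : |b| ≤ C * Real.exp (-k * |y|)) :
    |a * b| ≤ M * C * Real.exp (-k * |y|) := by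
  rw [abs_mul, mul_assoc]
  exact mul_le_mul ha hb (abs_nonneg _) ((abs_nonneg _).trans ha)

/-- **`∫∫ (∂ₓω)χ = −∫∫ χ′ω` over the period strip** for a `C²` divergence-free `L`-periodic slice with shear tails and
an `L`-periodic `C¹` function `χ(x)` (integration by parts in `x`; `|ω|, |∂ₓω| ≤ Ce^{−k|y|}`). [folklore] -/
theorem circLaw_integral_dX_vorticity_mul (hL : 0 < L) (hk : 0 < k) (hT : SliceTails C k f g)
    (hf : ContDiff ℝ 2 (fun q : ℝ × ℝ => f q.1 q.2)) (hg : ContDiff ℝ 2 (fun q : ℝ × ℝ => g q.1 q.2))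
    (hdiv : ∀ x y, dX f x y + dY g x y = 0) (hfper : ∀ x y, f (x + L) y = f x y)
    (hgper : ∀ x y, g (x + L) y = g x y) {χ χ' : ℝ → ℝ} (hχ : ∀ x, HasDerivAt χ (χ' x) x)
    (hχ'c : Continuous χ') (hχper : ∀ x, χ (x + L) = χ x) {A : ℝ} (hχA : ∀ x, |χ x| ≤ A)
    (hχ'A : ∀ x, |χ' x| ≤ A) :
    ∫ q in Ioc 0 L ×ˢ univ, dX (vorticity f g) q.1 q.2 * χ q.1 =
      -∫ q in Ioc 0 L ×ˢ univ, χ' q.1 * vorticity f g q.1 q.2 := by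
  have hC : 0 ≤ C := hT.nonneg
  have hω1 : ContDiff ℝ 1 (fun q : ℝ × ℝ => vorticity f g q.1 q.2) := contDiff_one_vorticity hf hg
  have cω : Continuous fun q : ℝ × ℝ => vorticity f g q.1 q.2 := hω1.continuous
  have cωx : Continuous fun q : ℝ × ℝ => dX (vorticity f g) q.1 q.2 := continuous_dX hω1
  have cχ : Continuous χ := continuous_iff_continuousAt.2 fun x => (hχ x).continuousAt
  have hωper : ∀ x y, vorticity f g (x + L) y = vorticity f g x y := fun x y => by
    simp only [StrainWorkSumRule.vorticity, dX_periodic hgper, dY_periodic hfper]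
  have i1 : IntegrableOn (fun q : ℝ × ℝ => χ q.1 * dX (vorticity f g) q.1 q.2) (Ioc 0 L ×ˢ univ) :=
    integrableOn_strip_bdd_mul_decay (K := fun x _ => χ x) hk (cχ.comp continuous_fst) cωx (fun x _ => hχA x) hC
      (clock_abs_dX_vorticity_le hT hf hg hdiv)
  have i2 : IntegrableOn (fun q : ℝ × ℝ => χ' q.1 * vorticity f g q.1 q.2) (Ioc 0 L ×ˢ univ) :=
    integrableOn_strip_bdd_mul_decay (K := fun x _ => χ' x) hk (hχ'c.comp continuous_fst) cω (fun x _ => hχ'A x) hC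
      (tails_abs_vorticity_le hT)
  have h := integral_strip_mul_dX_eq_neg (L := L) (f := fun x _ => χ x) (g := vorticity f g) (f' := fun x _ => χ' x)
    (g' := dX (vorticity f g)) hL.le (fun x _ => hχ x) (hasDerivAt_dX_of_contDiff hω1 one_ne_zero)
    (fun _ => hχ'c) (fun y => continuous_slice_x cωx y) (fun y => ?_) i1 i2
  · rw [← h]
    exact integral_congr_ae (Eventually.of_forall fun q => mul_comm _ _)
  · have h1 := hχper 0; have h2 := hωper 0 y
    rw [zero_add] at h1 h2
    rw [h1, h2]

/-- **`∫∫ ωuχ = −∫∫ χ′uv` over the period strip** for a `C²` divergence-free `L`-periodic slice `(u, v)` with shear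
tails and the shear far field `u → ±½`, and an `L`-periodic `C¹` function `χ(x)`: `ωu = u∂ₓv − u∂_yu`;
`∫∫ χ u∂_yu = −∫∫ 0·(u²/2) = 0` (integration by parts across the layer, the fluxes `χu²/2 → χ/8` cancel);
`∫∫ (χu)∂ₓv = −∫∫ (χ′u + χ∂ₓu)v` (in `x`, periodicity); `∫∫ χ(∂ₓu)v = −∫∫ χ v∂_yv = 0` (`∂ₓu = −∂_yv`, across the
layer, `v → 0`). [folklore] -/
theorem circLaw_integral_vorticity_mul_u (hL : 0 < L) (hk : 0 < k) (hT : SliceTails C k f g)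
    (hf : ContDiff ℝ 2 (fun q : ℝ × ℝ => f q.1 q.2)) (hg : ContDiff ℝ 2 (fun q : ℝ × ℝ => g q.1 q.2))
    (hdiv : ∀ x y, dX f x y + dY g x y = 0) (hfper : ∀ x y, f (x + L) y = f x y)
    (hgper : ∀ x y, g (x + L) y = g x y) (hft : ∀ x, Tendsto (fun y => f x y) atTop (𝓝 (1 / 2)))
    (hfb : ∀ x, Tendsto (fun y => f x y) atBot (𝓝 (-(1 / 2)))) {χ χ' : ℝ → ℝ}
    (hχ : ∀ x, HasDerivAt χ (χ' x) x) (hχ'c : Continuous χ') (hχper : ∀ x, χ (x + L) = χ x) {A : ℝ}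
    (hχA : ∀ x, |χ x| ≤ A) (hχ'A : ∀ x, |χ' x| ≤ A) :
    ∫ q in Ioc 0 L ×ˢ univ, vorticity f g q.1 q.2 * f q.1 q.2 * χ q.1 =
      -∫ q in Ioc 0 L ×ˢ univ, χ' q.1 * (f q.1 q.2 * g q.1 q.2) := by
  have hC : 0 ≤ C := hT.nonneg
  have hA : 0 ≤ A := (abs_nonneg _).trans (hχA 0)
  have hf1 : ContDiff ℝ 1 (fun q : ℝ × ℝ => f q.1 q.2) := hf.of_le one_le_two
  have hg1 : ContDiff ℝ 1 (fun q : ℝ × ℝ => g q.1 q.2) := hg.of_le one_le_two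
  have cf : Continuous fun q : ℝ × ℝ => f q.1 q.2 := hf.continuous
  have cg : Continuous fun q : ℝ × ℝ => g q.1 q.2 := hg.continuous
  have cfx := continuous_dX hf1
  have cfy := continuous_dY hf1
  have cgx := continuous_dX hg1
  have cgy := continuous_dY hg1
  have cχ : Continuous χ := continuous_iff_continuousAt.2 fun x => (hχ x).continuousAt
  have cχq : Continuous fun q : ℝ × ℝ => χ q.1 := cχ.comp continuous_fst
  have cχ'q : Continuous fun q : ℝ × ℝ => χ' q.1 := hχ'c.comp continuous_fst
  have hfB : ∀ x y, |f x y| ≤ 1 + C := hT.abs_u_le hk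
  have hgB : ∀ x y, |g x y| ≤ C := hT.abs_v_le_const hk
  have hle1 : ∀ y : ℝ, Real.exp (-k * |y|) ≤ 1 := fun y => Real.exp_le_one_iff.2 (by nlinarith [abs_nonneg y])
  have hfxB : ∀ x y, |dX f x y| ≤ C := fun x y => (hT.abs_dX_u_le x y).trans (mul_le_of_le_one_right hC (hle1 y))
  have hfx := hasDerivAt_dX_of_contDiff hf two_ne_zero
  have hfy := hasDerivAt_dY_of_contDiff hf two_ne_zero
  have hgx := hasDerivAt_dX_of_contDiff hg two_ne_zero
  have hgy := hasDerivAt_dY_of_contDiff hg two_ne_zero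
  -- tendsto of `g` across the layer
  have hgt : ∀ x, Tendsto (fun y => g x y) atTop (𝓝 0) := fun x =>
    tendsto_zero_atTop_of_abs_le_exp hk (hT.abs_v_le x)
  have hgb : ∀ x, Tendsto (fun y => g x y) atBot (𝓝 0) := fun x =>
    tendsto_zero_atBot_of_abs_le_exp hk (hT.abs_v_le x)
  -- integrability on the strip
  have iA : IntegrableOn (fun q : ℝ × ℝ => χ q.1 * (f q.1 q.2 * dY f q.1 q.2)) (Ioc 0 L ×ˢ univ) :=
    integrableOn_strip_bdd_mul_decay (K := fun x _ => χ x) hk cχq (cf.mul cfy) (fun x _ => hχA x) (by positivity)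
      fun x y => circLaw_abs_mul_le (hfB x y) (hT.abs_dY_u_le x y)
  have iC : IntegrableOn (fun q : ℝ × ℝ => χ q.1 * f q.1 q.2 * dX g q.1 q.2) (Ioc 0 L ×ˢ univ) :=
    integrableOn_strip_bdd_mul_decay (K := fun x y => χ x * f x y) hk (cχq.mul cf) cgx
      (fun x y => by rw [abs_mul]; exact mul_le_mul (hχA x) (hfB x y) (abs_nonneg _) hA) hC (hT.abs_dX_v_le)
  have iD : IntegrableOn (fun q : ℝ × ℝ => (χ' q.1 * f q.1 q.2 + χ q.1 * dX f q.1 q.2) * g q.1 q.2)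
      (Ioc 0 L ×ˢ univ) :=
    integrableOn_strip_bdd_mul_decay (K := fun x y => χ' x * f x y + χ x * dX f x y) (A := A * (1 + C) + A * C) hk
      ((cχ'q.mul cf).add (cχq.mul cfx)) cg (fun x y => (abs_add_le _ _).trans (add_le_add
        (by rw [abs_mul]; exact mul_le_mul (hχ'A x) (hfB x y) (abs_nonneg _) hA)
        (by rw [abs_mul]; exact mul_le_mul (hχA x) (hfxB x y) (abs_nonneg _) hA))) hC (hT.abs_v_le)
  have iE : IntegrableOn (fun q : ℝ × ℝ => χ q.1 * (g q.1 q.2 * dY g q.1 q.2)) (Ioc 0 L ×ˢ univ) :=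
    integrableOn_strip_bdd_mul_decay (K := fun x _ => χ x) hk cχq (cg.mul cgy) (fun x _ => hχA x) (by positivity)
      fun x y => circLaw_abs_mul_le (hgB x y) (hT.abs_dY_v_le x y)
  have iG : IntegrableOn (fun q : ℝ × ℝ => χ' q.1 * (f q.1 q.2 * g q.1 q.2)) (Ioc 0 L ×ˢ univ) :=
    integrableOn_strip_bdd_mul_decay (K := fun x _ => χ' x) hk cχ'q (cf.mul cg) (fun x _ => hχ'A x) (by positivity)
      fun x y => circLaw_abs_mul_le (hfB x y) (hT.abs_v_le x y)
  have iH : IntegrableOn (fun q : ℝ × ℝ => χ q.1 * dX f q.1 q.2 * g q.1 q.2) (Ioc 0 L ×ˢ univ) :=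
    integrableOn_strip_bdd_mul_decay (K := fun x y => χ x * dX f x y) hk (cχq.mul cfx) cg
      (fun x y => by rw [abs_mul]; exact mul_le_mul (hχA x) (hfxB x y) (abs_nonneg _) hA) hC (hT.abs_v_le)
  -- (i) `∫∫ χ u ∂_yu = 0`
  have e1 : ∫ q in Ioc 0 L ×ˢ univ, χ q.1 * (f q.1 q.2 * dY f q.1 q.2) = 0 := by
    have h := integral_strip_mul_dY_eq_neg_of_tendsto (L := L) (f := fun x _ => χ x)
      (g := fun x y => f x y * f x y / 2) (f' := fun _ _ => (0:ℝ)) (g' := fun x y => f x y * dY f x y)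
      (l := fun x => χ x * (1 / 2 * (1 / 2) / 2)) (fun x y => hasDerivAt_const y (χ x))
      (fun x y => (((hfy x y).fun_mul (hfy x y)).div_const 2).congr_deriv (by ring)) iA
      (by simpa only [zero_mul] using integrableOn_zero)
      (fun x => by
        have h := (((hfb x).mul (hfb x)).div_const 2).const_mul (χ x)
        rwa [show -(1 / 2 : ℝ) * -(1 / 2) / 2 = 1 / 2 * (1 / 2) / 2 by norm_num] at h)
      (fun x => (((hft x).mul (hft x)).div_const 2).const_mul (χ x))
    simpa using h
  -- (ii) `∫∫ (χu)∂ₓv = −∫∫ (χ′u + χ∂ₓu)v`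
  have e2 : ∫ q in Ioc 0 L ×ˢ univ, χ q.1 * f q.1 q.2 * dX g q.1 q.2 =
      -∫ q in Ioc 0 L ×ˢ univ, (χ' q.1 * f q.1 q.2 + χ q.1 * dX f q.1 q.2) * g q.1 q.2 := by
    refine integral_strip_mul_dX_eq_neg (f := fun x y => χ x * f x y) (f' := fun x y => χ' x * f x y + χ x * dX f x y)
      hL.le (fun x y => (hχ x).fun_mul (hfx x y)) hgx (fun y => by fun_prop) (fun y => continuous_slice_x cgx y)
      (fun y => ?_) iC iD
    have h1 := hχper 0; have h2 := hfper 0 y; have h3 := hgper 0 y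
    rw [zero_add] at h1 h2 h3
    simp only [h1, h2, h3]
  -- (iii) `∫∫ χ(∂ₓu)v = −∫∫ χ v ∂_yv = 0`
  have e3 : ∫ q in Ioc 0 L ×ˢ univ, χ q.1 * (g q.1 q.2 * dY g q.1 q.2) = 0 := by
    have h := integral_strip_mul_dY_eq_neg_of_tendsto (L := L) (f := fun x _ => χ x)
      (g := fun x y => g x y * g x y / 2) (f' := fun _ _ => (0:ℝ)) (g' := fun x y => g x y * dY g x y)
      (l := fun x => χ x * (0 * 0 / 2)) (fun x y => hasDerivAt_const y (χ x))
      (fun x y => (((hgy x y).fun_mul (hgy x y)).div_const 2).congr_deriv (by ring)) iE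
      (by simpa only [zero_mul] using integrableOn_zero)
      (fun x => (((hgb x).mul (hgb x)).div_const 2).const_mul (χ x))
      (fun x => (((hgt x).mul (hgt x)).div_const 2).const_mul (χ x))
    simpa using h
  have e4 : ∫ q in Ioc 0 L ×ˢ univ, χ q.1 * dX f q.1 q.2 * g q.1 q.2 =
      -∫ q in Ioc 0 L ×ˢ univ, χ q.1 * (g q.1 q.2 * dY g q.1 q.2) := by
    rw [← integral_neg]
    refine integral_congr_ae (Eventually.of_forall fun q => ?_)
    have h := hdiv q.1 q.2
    simp only
    rw [show dX f q.1 q.2 = -dY g q.1 q.2 by linarith]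
    ring
  -- assemble
  have e5 : ∫ q in Ioc 0 L ×ˢ univ, vorticity f g q.1 q.2 * f q.1 q.2 * χ q.1 =
      (∫ q in Ioc 0 L ×ˢ univ, χ q.1 * f q.1 q.2 * dX g q.1 q.2) -
        ∫ q in Ioc 0 L ×ˢ univ, χ q.1 * (f q.1 q.2 * dY f q.1 q.2) := by
    rw [← integral_sub iC iA]
    exact integral_congr_ae (Eventually.of_forall fun q => by simp only [StrainWorkSumRule.vorticity]; ring)
  have e6 : ∫ q in Ioc 0 L ×ˢ univ, (χ' q.1 * f q.1 q.2 + χ q.1 * dX f q.1 q.2) * g q.1 q.2 =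
      (∫ q in Ioc 0 L ×ˢ univ, χ' q.1 * (f q.1 q.2 * g q.1 q.2)) +
        ∫ q in Ioc 0 L ×ˢ univ, χ q.1 * dX f q.1 q.2 * g q.1 q.2 := by
    rw [← integral_add iG iH]
    exact integral_congr_ae (Eventually.of_forall fun q => by simp only; ring)
  rw [e5, e1, sub_zero, e2, e6, e4, e3, neg_zero, add_zero]

end SliceFacts

/-! ## Removing the cutoff at one instant: majorants and limits `R → ∞` -/

section Limits

variable {L C k A D : ℝ} {f g : ℝ → ℝ → ℝ} {φ φ' : ℝ → ℝ} {ψ : ℝ → ℝ → ℝ}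

/-- `|φψ_R ω| ≤ AC e^{−k|y|}` (`|φ| ≤ A`, `|ψ_R| ≤ 1`). [folklore] -/
theorem circLaw_N_bound (hT : SliceTails C k f g) (hφA : ∀ x, |φ x| ≤ A) (hψ1 : ∀ R y, |ψ R y| ≤ 1) (R : ℝ)
    (q : ℝ × ℝ) : |φ q.1 * ψ R q.2 * vorticity f g q.1 q.2| ≤ A * C * Real.exp (-k * |q.2|) := by
  have hA : 0 ≤ A := (abs_nonneg _).trans (hφA 0)
  refine circLaw_abs_mul_le ?_ (tails_abs_vorticity_le hT q.1 q.2)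
  rw [abs_mul]
  calc |φ q.1| * |ψ R q.2| ≤ A * 1 := mul_le_mul (hφA _) (hψ1 R _) (abs_nonneg _) hA
    _ = A := mul_one A

/-- `|ω(uφ′ψ_R + (v − y)φψ_R′)| ≤ AC(1 + C)e^{−k|y|} + ACD(C + |y|)e^{−k|y|}` (`|φ|, |φ′| ≤ A`, `|ψ_R| ≤ 1`,
`|ψ_R′| ≤ D`). [folklore] -/
theorem circLaw_I1_bound (hk : 0 < k) (hT : SliceTails C k f g) (hφA : ∀ x, |φ x| ≤ A) (hφ'A : ∀ x, |φ' x| ≤ A)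
    (hψ1 : ∀ R y, |ψ R y| ≤ 1) {R : ℝ} (hψ'D : ∀ y, |deriv (ψ R) y| ≤ D) (q : ℝ × ℝ) :
    |vorticity f g q.1 q.2 * (f q.1 q.2 * (φ' q.1 * ψ R q.2) + (g q.1 q.2 - q.2) * (φ q.1 * deriv (ψ R) q.2))| ≤
      A * C * (1 + C) * Real.exp (-k * |q.2|) + A * C * D * ((C + |q.2|) * Real.exp (-k * |q.2|)) := by
  have hC : 0 ≤ C := hT.nonneg
  have hA : 0 ≤ A := (abs_nonneg _).trans (hφA 0)
  have h1 := tails_abs_vorticity_le hT q.1 q.2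
  have h2 : |f q.1 q.2 * (φ' q.1 * ψ R q.2)| ≤ (1 + C) * A := by
    rw [abs_mul, abs_mul]
    calc |f q.1 q.2| * (|φ' q.1| * |ψ R q.2|) ≤ (1 + C) * (A * 1) :=
          mul_le_mul (hT.abs_u_le hk _ _) (mul_le_mul (hφ'A _) (hψ1 R _) (abs_nonneg _) hA) (by positivity)
            (by positivity)
      _ = (1 + C) * A := by ring
  have h3 : |(g q.1 q.2 - q.2) * (φ q.1 * deriv (ψ R) q.2)| ≤ (C + |q.2|) * (A * D) := by
    rw [abs_mul, abs_mul]
    exact mul_le_mul ((abs_sub _ _).trans (add_le_add (hT.abs_v_le_const hk _ _) le_rfl))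
      (mul_le_mul (hφA _) (hψ'D _) (abs_nonneg _) hA) (by positivity) (by positivity)
  rw [abs_mul]
  calc |vorticity f g q.1 q.2| * |f q.1 q.2 * (φ' q.1 * ψ R q.2) + (g q.1 q.2 - q.2) * (φ q.1 * deriv (ψ R) q.2)|
      ≤ C * Real.exp (-k * |q.2|) * ((1 + C) * A + (C + |q.2|) * (A * D)) :=
        mul_le_mul h1 ((abs_add_le _ _).trans (add_le_add h2 h3)) (abs_nonneg _) (by positivity)
    _ = A * C * (1 + C) * Real.exp (-k * |q.2|) + A * C * D * ((C + |q.2|) * Real.exp (-k * |q.2|)) := by ring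

/-- `|∂ₓω φ′ψ_R + ∂_yω φψ_R′| ≤ AC(1 + D)e^{−k|y|}` (`|φ|, |φ′| ≤ A`, `|ψ_R| ≤ 1`, `|ψ_R′| ≤ D`;
`|∂ₓω|, |∂_yω| ≤ Ce^{−k|y|}` for a `C²` divergence-free slice). [folklore] -/
theorem circLaw_I2_bound (hT : SliceTails C k f g) (hf : ContDiff ℝ 2 (fun q : ℝ × ℝ => f q.1 q.2))
    (hg : ContDiff ℝ 2 (fun q : ℝ × ℝ => g q.1 q.2)) (hdiv : ∀ x y, dX f x y + dY g x y = 0)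
    (hφA : ∀ x, |φ x| ≤ A) (hφ'A : ∀ x, |φ' x| ≤ A) (hψ1 : ∀ R y, |ψ R y| ≤ 1) {R : ℝ}
    (hψ'D : ∀ y, |deriv (ψ R) y| ≤ D) (q : ℝ × ℝ) :
    |dX (vorticity f g) q.1 q.2 * (φ' q.1 * ψ R q.2) + dY (vorticity f g) q.1 q.2 * (φ q.1 * deriv (ψ R) q.2)| ≤
      A * C * (1 + D) * Real.exp (-k * |q.2|) := by
  have hC : 0 ≤ C := hT.nonneg
  have hA : 0 ≤ A := (abs_nonneg _).trans (hφA 0)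
  have h1 : |dX (vorticity f g) q.1 q.2 * (φ' q.1 * ψ R q.2)| ≤ C * Real.exp (-k * |q.2|) * (A * 1) := by
    rw [abs_mul, abs_mul]
    exact mul_le_mul (clock_abs_dX_vorticity_le hT hf hg hdiv _ _)
      (mul_le_mul (hφ'A _) (hψ1 R _) (abs_nonneg _) hA) (by positivity) (by positivity)
  have h2 : |dY (vorticity f g) q.1 q.2 * (φ q.1 * deriv (ψ R) q.2)| ≤ C * Real.exp (-k * |q.2|) * (A * D) := by
    rw [abs_mul, abs_mul]
    exact mul_le_mul (kato_abs_dY_vorticity_le hT hf hg hdiv _ _)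
      (mul_le_mul (hφA _) (hψ'D _) (abs_nonneg _) hA) (by positivity) (by positivity)
  calc _ ≤ C * Real.exp (-k * |q.2|) * (A * 1) + C * Real.exp (-k * |q.2|) * (A * D) :=
        (abs_add_le _ _).trans (add_le_add h1 h2)
    _ = A * C * (1 + D) * Real.exp (-k * |q.2|) := by ring

/-- **`∫∫ φψ_R ω → ∫∫ φω`** as `R → ∞` (dominated convergence on the strip; `ψ_R(y) = 1` eventually). [folklore] -/
theorem circLaw_limit_N (hk : 0 < k) (hT : SliceTails C k f g) (hf : ContDiff ℝ 2 (fun q : ℝ × ℝ => f q.1 q.2))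
    (hg : ContDiff ℝ 2 (fun q : ℝ × ℝ => g q.1 q.2)) (cφ : Continuous φ) (hφA : ∀ x, |φ x| ≤ A)
    (hψc : ∀ R, Continuous (ψ R)) (hψ1 : ∀ R y, |ψ R y| ≤ 1)
    (hψev : ∀ y, ∀ᶠ R in atTop, ψ R y = 1 ∧ deriv (ψ R) y = 0) :
    Tendsto (fun R : ℝ => ∫ q in Ioc 0 L ×ˢ univ, φ q.1 * ψ R q.2 * vorticity f g q.1 q.2) atTop
      (𝓝 (∫ q in Ioc 0 L ×ˢ univ, φ q.1 * vorticity f g q.1 q.2)) := by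
  have cω : Continuous fun q : ℝ × ℝ => vorticity f g q.1 q.2 := (contDiff_one_vorticity hf hg).continuous
  refine tendsto_integral_filter_of_dominated_convergence (fun q => A * C * Real.exp (-k * |q.2|)) ?_ ?_ ?_ ?_
  · exact Eventually.of_forall fun R =>
      (((cφ.comp continuous_fst).mul ((hψc R).comp continuous_snd)).mul cω).aestronglyMeasurable
  · exact Eventually.of_forall fun R => Eventually.of_forall fun q => by
      rw [Real.norm_eq_abs]; exact circLaw_N_bound hT hφA hψ1 R q
  · exact (kato_integrableOn_weight hk L).const_mul _
  · refine Eventually.of_forall fun q => tendsto_const_nhds.congr' ?_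
    filter_upwards [hψev q.2] with R hR
    rw [hR.1, mul_one]

/-- **`∫∫ ω(uφ′ψ_R + (v − y)φψ_R′) → ∫∫ ωuφ′`** as `R → ∞` (dominated convergence on the strip; `ψ_R = 1`, `ψ_R′ = 0`
eventually, `|ψ_R′| ≤ D` for `R ≥ 1`). [folklore] -/
theorem circLaw_limit_I1 (hk : 0 < k) (hT : SliceTails C k f g) (hf : ContDiff ℝ 2 (fun q : ℝ × ℝ => f q.1 q.2))
    (hg : ContDiff ℝ 2 (fun q : ℝ × ℝ => g q.1 q.2)) (cφ : Continuous φ) (cφ' : Continuous φ')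
    (hφA : ∀ x, |φ x| ≤ A) (hφ'A : ∀ x, |φ' x| ≤ A) (hψc : ∀ R, Continuous (ψ R))
    (hψ'c : ∀ R, Continuous (deriv (ψ R))) (hψ1 : ∀ R y, |ψ R y| ≤ 1)
    (hψ'D : ∀ R, 1 ≤ R → ∀ y, |deriv (ψ R) y| ≤ D) (hψev : ∀ y, ∀ᶠ R in atTop, ψ R y = 1 ∧ deriv (ψ R) y = 0) :
    Tendsto (fun R : ℝ => ∫ q in Ioc 0 L ×ˢ univ, vorticity f g q.1 q.2 *
      (f q.1 q.2 * (φ' q.1 * ψ R q.2) + (g q.1 q.2 - q.2) * (φ q.1 * deriv (ψ R) q.2))) atTop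
      (𝓝 (∫ q in Ioc 0 L ×ˢ univ, vorticity f g q.1 q.2 * f q.1 q.2 * φ' q.1)) := by
  have hC : 0 ≤ C := hT.nonneg
  have cω : Continuous fun q : ℝ × ℝ => vorticity f g q.1 q.2 := (contDiff_one_vorticity hf hg).continuous
  have cf : Continuous fun q : ℝ × ℝ => f q.1 q.2 := hf.continuous
  have cg : Continuous fun q : ℝ × ℝ => g q.1 q.2 := hg.continuous
  refine tendsto_integral_filter_of_dominated_convergence (fun q => A * C * (1 + C) * Real.exp (-k * |q.2|) +
    A * C * D * ((C + |q.2|) * Real.exp (-k * |q.2|))) ?_ ?_ ?_ ?_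
  · refine Eventually.of_forall fun R => Continuous.aestronglyMeasurable ?_
    have c1 : Continuous fun q : ℝ × ℝ => ψ R q.2 := (hψc R).comp continuous_snd
    have c2 : Continuous fun q : ℝ × ℝ => deriv (ψ R) q.2 := (hψ'c R).comp continuous_snd
    have c3 : Continuous fun q : ℝ × ℝ => φ q.1 := cφ.comp continuous_fst
    have c4 : Continuous fun q : ℝ × ℝ => φ' q.1 := cφ'.comp continuous_fst
    exact cω.mul ((cf.mul (c4.mul c1)).add ((cg.sub continuous_snd).mul (c3.mul c2)))
  · filter_upwards [eventually_ge_atTop 1] with R hR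
    exact Eventually.of_forall fun q => by
      rw [Real.norm_eq_abs]; exact circLaw_I1_bound hk hT hφA hφ'A hψ1 (hψ'D R hR) q
  · exact ((kato_integrableOn_weight hk L).const_mul _).add ((kato_integrableOn_weight' hk hC L).const_mul _)
  · refine Eventually.of_forall fun q => tendsto_const_nhds.congr' ?_
    filter_upwards [hψev q.2] with R hR
    rw [hR.1, hR.2]
    ring

/-- **`∫∫ (∂ₓω φ′ψ_R + ∂_yω φψ_R′) → ∫∫ ∂ₓω φ′`** as `R → ∞` (dominated convergence on the strip). [folklore] -/
theorem circLaw_limit_I2 (hk : 0 < k) (hT : SliceTails C k f g) (hf : ContDiff ℝ 2 (fun q : ℝ × ℝ => f q.1 q.2))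
    (hg : ContDiff ℝ 2 (fun q : ℝ × ℝ => g q.1 q.2)) (hdiv : ∀ x y, dX f x y + dY g x y = 0) (cφ : Continuous φ)
    (cφ' : Continuous φ') (hφA : ∀ x, |φ x| ≤ A) (hφ'A : ∀ x, |φ' x| ≤ A) (hψc : ∀ R, Continuous (ψ R))
    (hψ'c : ∀ R, Continuous (deriv (ψ R))) (hψ1 : ∀ R y, |ψ R y| ≤ 1)
    (hψ'D : ∀ R, 1 ≤ R → ∀ y, |deriv (ψ R) y| ≤ D) (hψev : ∀ y, ∀ᶠ R in atTop, ψ R y = 1 ∧ deriv (ψ R) y = 0) :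
    Tendsto (fun R : ℝ => ∫ q in Ioc 0 L ×ˢ univ, (dX (vorticity f g) q.1 q.2 * (φ' q.1 * ψ R q.2) +
      dY (vorticity f g) q.1 q.2 * (φ q.1 * deriv (ψ R) q.2))) atTop
      (𝓝 (∫ q in Ioc 0 L ×ˢ univ, dX (vorticity f g) q.1 q.2 * φ' q.1)) := by
  have hω1 : ContDiff ℝ 1 (fun q : ℝ × ℝ => vorticity f g q.1 q.2) := contDiff_one_vorticity hf hg
  have cωx : Continuous fun q : ℝ × ℝ => dX (vorticity f g) q.1 q.2 := continuous_dX hω1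
  have cωy : Continuous fun q : ℝ × ℝ => dY (vorticity f g) q.1 q.2 := continuous_dY hω1
  refine tendsto_integral_filter_of_dominated_convergence (fun q => A * C * (1 + D) * Real.exp (-k * |q.2|))
    ?_ ?_ ?_ ?_
  · refine Eventually.of_forall fun R => Continuous.aestronglyMeasurable ?_
    have c1 : Continuous fun q : ℝ × ℝ => ψ R q.2 := (hψc R).comp continuous_snd
    have c2 : Continuous fun q : ℝ × ℝ => deriv (ψ R) q.2 := (hψ'c R).comp continuous_snd
    have c3 : Continuous fun q : ℝ × ℝ => φ q.1 := cφ.comp continuous_fst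
    have c4 : Continuous fun q : ℝ × ℝ => φ' q.1 := cφ'.comp continuous_fst
    exact (cωx.mul (c4.mul c1)).add (cωy.mul (c3.mul c2))
  · filter_upwards [eventually_ge_atTop 1] with R hR
    exact Eventually.of_forall fun q => by
      rw [Real.norm_eq_abs]; exact circLaw_I2_bound hT hf hg hdiv hφA hφ'A hψ1 (hψ'D R hR) q
  · exact (kato_integrableOn_weight hk L).const_mul _
  · refine Eventually.of_forall fun q => tendsto_const_nhds.congr' ?_
    filter_upwards [hψev q.2] with R hR
    rw [hR.1, hR.2]
    ring

end Limits

/-! ## The registered tools sub-goal -/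

/-- **Tools for `circulationDensity_weak_law` (registered sub-goal `circLaw_tools`).** For a `C²` divergence-free
`L`-periodic slice `(u, v)` with shear tails `SliceTails C k` (`L, k > 0`) and an `L`-periodic `C¹` function `χ` with
`|χ|, |χ′| ≤ A`: `∫∫ (∂ₓω)χ = −∫∫ χ′ω`, and, under the shear far field `u → ±½`, `∫∫ ωuχ = −∫∫ χ′uv` (period strip,
product-measure form). [folklore] -/
theorem circLaw_tools : ∀ (L C k A : ℝ) (f g : ℝ → ℝ → ℝ) (χ χ' : ℝ → ℝ), 0 < L → 0 < k → SliceTails C k f g →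
    ContDiff ℝ 2 (fun q : ℝ × ℝ => f q.1 q.2) → ContDiff ℝ 2 (fun q : ℝ × ℝ => g q.1 q.2) →
    (∀ x y, dX f x y + dY g x y = 0) → (∀ x y, f (x + L) y = f x y) → (∀ x y, g (x + L) y = g x y) →
    (∀ x, HasDerivAt χ (χ' x) x) → Continuous χ' → (∀ x, χ (x + L) = χ x) → (∀ x, |χ x| ≤ A) →
    (∀ x, |χ' x| ≤ A) →
      (∫ q in Ioc 0 L ×ˢ univ, dX (vorticity f g) q.1 q.2 * χ q.1 =
        -∫ q in Ioc 0 L ×ˢ univ, χ' q.1 * vorticity f g q.1 q.2) ∧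
      ((∀ x, Tendsto (fun y => f x y) atTop (𝓝 (1 / 2))) → (∀ x, Tendsto (fun y => f x y) atBot (𝓝 (-(1 / 2)))) →
        ∫ q in Ioc 0 L ×ˢ univ, vorticity f g q.1 q.2 * f q.1 q.2 * χ q.1 =
          -∫ q in Ioc 0 L ×ˢ univ, χ' q.1 * (f q.1 q.2 * g q.1 q.2)) :=
  fun _ _ _ _ _ _ _ _ hL hk hT hf hg hdiv hfper hgper hχ hχ'c hχper hχA hχ'A =>
    ⟨circLaw_integral_dX_vorticity_mul hL hk hT hf hg hdiv hfper hgper hχ hχ'c hχper hχA hχ'A,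
      fun hft hfb => circLaw_integral_vorticity_mul_u hL hk hT hf hg hdiv hfper hgper hft hfb hχ hχ'c hχper hχA hχ'A⟩

end Summit.AnomalousDissipation.AnomalousDissipation.Theorems.StrainedLayerLaw.LogEnstrophyClock

end
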